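import Summits.Ventures.MM22.Rank333.W5P1Data0
import Summits.Ventures.MM22.Rank333.W5P1Data1
import Summits.Ventures.MM22.Rank234.RealizeKids
import HarnessLib

/-!
# MM22 venture — profile class P1: chunked child replays, file 0

HONEST FRAMING (cell `pub-mm22`, p3 lineage emitter `rcemit.py`; certificate = engine-1-format refutation tree; generator rules = the
landed `Rank234/RealizeCheck.lean`): DATA / REPLAY for ONE profile class (P1). It is NOT any part of a census statement — one class
proves nothing about the other classes; it is the per-class kernel leg, packaged to pass the gate (≤ 400 lines, small decides).
-/

set_option Elab.async false
set_option maxRecDepth 100000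

namespace Summit.Ventures.MM22.GF2Cert.Realize.W5P1

open Summit.Ventures.MM22.GF2Cert.Realize Summit.MatrixMultiplication.OmegaCensus.GF2RankLB
open Literature.Computability.AlgebraicComplexity Summit.Ventures.MM22.GF2Cert.Profile

set_option maxHeartbeats 0 in
/-- Chunk 0 of `kids1_1` (30 subtrees) passes the replay. -/
theorem ch1_1_0 : ((kids1_1.drop (30 * 0)).take 30).all (fun e => decide (e.1 < 512) && e.2.check 3 3 3 [] phP1 ([(511, 8)] ++ [(365, e.1)])) = true := by
  decide +kernel

set_option maxHeartbeats 0 in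
/-- Chunk 1 of `kids1_1` (30 subtrees) passes the replay. -/
theorem ch1_1_1 : ((kids1_1.drop (30 * 1)).take 30).all (fun e => decide (e.1 < 512) && e.2.check 3 3 3 [] phP1 ([(511, 8)] ++ [(365, e.1)])) = true := by
  decide +kernel

set_option maxHeartbeats 0 in
/-- Chunk 2 of `kids1_1` (30 subtrees) passes the replay. -/
theorem ch1_1_2 : ((kids1_1.drop (30 * 2)).take 30).all (fun e => decide (e.1 < 512) && e.2.check 3 3 3 [] phP1 ([(511, 8)] ++ [(365, e.1)])) = true := by
  decide +kernel

set_option maxHeartbeats 0 in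
/-- Chunk 3 of `kids1_1` (30 subtrees) passes the replay. -/
theorem ch1_1_3 : ((kids1_1.drop (30 * 3)).take 30).all (fun e => decide (e.1 < 512) && e.2.check 3 3 3 [] phP1 ([(511, 8)] ++ [(365, e.1)])) = true := by
  decide +kernel

set_option maxHeartbeats 0 in
/-- Chunk 4 of `kids1_1` (30 subtrees) passes the replay. -/
theorem ch1_1_4 : ((kids1_1.drop (30 * 4)).take 30).all (fun e => decide (e.1 < 512) && e.2.check 3 3 3 [] phP1 ([(511, 8)] ++ [(365, e.1)])) = true := by
  decide +kernel

set_option maxHeartbeats 0 in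
/-- Chunk 5 of `kids1_1` (30 subtrees) passes the replay. -/
theorem ch1_1_5 : ((kids1_1.drop (30 * 5)).take 30).all (fun e => decide (e.1 < 512) && e.2.check 3 3 3 [] phP1 ([(511, 8)] ++ [(365, e.1)])) = true := by
  decide +kernel

set_option maxHeartbeats 0 in
/-- Chunk 6 of `kids1_1` (30 subtrees) passes the replay. -/
theorem ch1_1_6 : ((kids1_1.drop (30 * 6)).take 30).all (fun e => decide (e.1 < 512) && e.2.check 3 3 3 [] phP1 ([(511, 8)] ++ [(365, e.1)])) = true := by
  decide +kernel

set_option maxHeartbeats 0 in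
/-- Chunk 7 of `kids1_1` (30 subtrees) passes the replay. -/
theorem ch1_1_7 : ((kids1_1.drop (30 * 7)).take 30).all (fun e => decide (e.1 < 512) && e.2.check 3 3 3 [] phP1 ([(511, 8)] ++ [(365, e.1)])) = true := by
  decide +kernel

set_option maxHeartbeats 0 in
/-- Chunk 8 of `kids1_1` (30 subtrees) passes the replay. -/
theorem ch1_1_8 : ((kids1_1.drop (30 * 8)).take 30).all (fun e => decide (e.1 < 512) && e.2.check 3 3 3 [] phP1 ([(511, 8)] ++ [(365, e.1)])) = true := by
  decide +kernel

end Summit.Ventures.MM22.GF2Cert.Realize.W5P1
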